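import Mathlib
import HarnessLib
import Summits.AtomisticToContinuum.Crystallization.Theses.PricedLinkCensus
import Literature.MathematicalPhysics.StatisticalMechanics.LennardJonesThermodynamicLimitProofs

/-!
# AtomisticToContinuum / Crystallization — route `PricedLinkCensus`, item `GapConsequences`

Settles `stmt-AtomisticToContinuum-13890` (`GapConsequences`, bookkeeping glue of the route
`PricedLinkCensus`):

  `ChargedEnergyGap → CrysEnergyUpper → ZeroChargeBulk ∧ (E(N)/N → ⨅_Q e(Q))`.

Write `E(N)` for the `N`-particle Lennard-Jones ground-state energy in `ℝ³` and
`e* = ⨅_Q e(Q)` for the infimum over periodic configurations of the energy per particle.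

* By the thermodynamic limit (Blanc–Lewin 2015, §1.3 (8); tree theorem
  `BlancLewin2015_8_holds`) `E(N)/N → e` for some real `e`.
* `CrysEnergyUpper` (`limsup E(N)/N ≤ e*`) gives `e ≤ e*`.
* `ChargedEnergyGap` evaluated at a ground state (which exists,
  `exists_isGroundState_lennardJones`), dropping the non-negative charge term
  `κ · #(charged sites)`, gives `N e* − C N^{2/3} ≤ E(N)`,
  hence `e* − C N^{2/3}/N ≤ E(N)/N` and, since `N^{2/3}/N = N^{−1/3} → 0`, `e* ≤ e`.
* So `e = e*`, which is the second conjunct; and the charged fraction obeys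
  `0 ≤ #(charged)/N ≤ ((E(N)/N − e*) + C N^{2/3}/N)/κ → 0`, which is `ZeroChargeBulk`.

Pure soft analysis (Mathlib filters); no new definitions, no named-fact hypotheses.
-/

namespace Summit.AtomisticToContinuum.Crystallization.Theorems

open Filter Topology
open Literature.MathematicalPhysics.StatisticalMechanics

/-- `N^{2/3}/N → 0` along the naturals (it equals `N^{-1/3}` for `N ≥ 1`). [folklore] -/
theorem tendsto_rpow_two_thirds_div_self :
    Tendsto (fun N : ℕ => ((N : ℝ) ^ (2 / 3 : ℝ)) / (N : ℝ)) atTop (𝓝 0) := by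
  have h : Tendsto (fun N : ℕ => (N : ℝ) ^ (-(1 / 3 : ℝ))) atTop (𝓝 0) :=
    (tendsto_rpow_neg_atTop (by norm_num : (0 : ℝ) < 1 / 3)).comp tendsto_natCast_atTop_atTop
  refine h.congr' ?_
  filter_upwards [eventually_gt_atTop 0] with N hN
  have hN' : (0 : ℝ) < N := by exact_mod_cast hN
  have : (-(1 / 3 : ℝ)) = (2 / 3 : ℝ) - 1 := by norm_num
  rw [this, Real.rpow_sub_one hN'.ne']

/-- **`GapConsequences`** (item `stmt-AtomisticToContinuum-13890` of route `PricedLinkCensus`):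
the priced energy gap `ChargedEnergyGap` and the trial-state upper bound `CrysEnergyUpper` imply
(i) `ZeroChargeBulk` — the fraction of sites of Lennard-Jones ground states in `ℝ³` that are
not charge-free at tolerance `1/100` tends to `0` — and (ii) `E(N)/N → ⨅_Q e(Q)`, the infimum over
periodic configurations of the Lennard-Jones energy per particle (this second conjunct is the shared
item `CrysEnergyLimit`). Proof: `E(N)/N → e` (Blanc–Lewin 2015 (8), `BlancLewin2015_8_holds`);
`e ≤ ⨅` from the `limsup` bound; `⨅ ≤ e` from the gap at a ground state with the charge term
dropped and `N^{2/3}/N → 0`; then squeeze the charged fraction by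
`((E(N)/N − ⨅) + C N^{2/3}/N)/κ → 0`. [folklore] -/
theorem gapConsequences_proof :
    Summit.AtomisticToContinuum.Crystallization.Theses.PricedLinkCensus.GapConsequences := by
  unfold Summit.AtomisticToContinuum.Crystallization.Theses.PricedLinkCensus.GapConsequences
    Summit.AtomisticToContinuum.Crystallization.Theses.PricedLinkCensus.ChargedEnergyGap
    Summit.AtomisticToContinuum.Crystallization.Theses.PricedLinkCensus.CrysEnergyUpper
    Summit.AtomisticToContinuum.Crystallization.Theses.PricedLinkCensus.ZeroChargeBulk
  rintro ⟨κ, C, hκ, hgap⟩ hUB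
  -- notation
  set eStar : ℝ := ⨅ Q : PeriodicConfiguration 3, Q.energyPerParticle lennardJones with heStar
  set E : ℕ → ℝ := fun N => groundStateEnergy lennardJones 3 N with hE
  -- (8): the thermodynamic limit exists
  obtain ⟨e, -, he_lim, -⟩ := BlancLewin2015_8_holds 3 (by norm_num) (by norm_num)
  change Tendsto (fun N : ℕ => E N / N) atTop (𝓝 e) at he_lim
  -- upper bound: e ≤ e*
  have h_le : e ≤ eStar := by
    rw [← he_lim.limsup_eq]
    exact hUB
  -- lower bound from the gap at a ground state: N e* - C N^{2/3} ≤ E(N)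
  have h_gapE : ∀ N : ℕ, (N : ℝ) * eStar - C * (N : ℝ) ^ (2 / 3 : ℝ) ≤ E N := by
    intro N
    obtain ⟨x, hx_inj, hx_E⟩ := exists_isGroundState_lennardJones (d := 3) (by norm_num) N
    have h1 := hgap N x hx_inj
    have h2 : (0 : ℝ) ≤ κ * (Nat.card {i : Fin N //
        ¬ Literature.Geometry.DiscreteGeometry.IsChargeFree (1 / 100 : ℝ) x i} : ℝ) :=
      mul_nonneg hκ.le (Nat.cast_nonneg _)
    have h3 : interactionEnergy lennardJones x = E N := hx_E
    linarith
  have h_div : ∀ᶠ N : ℕ in atTop,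
      eStar - C * (((N : ℝ) ^ (2 / 3 : ℝ)) / (N : ℝ)) ≤ E N / N := by
    filter_upwards [eventually_gt_atTop 0] with N hN
    have hN' : (0 : ℝ) < N := by exact_mod_cast hN
    rw [le_div_iff₀ hN', sub_mul, mul_comm eStar (N : ℝ), mul_assoc C,
      div_mul_cancel₀ _ hN'.ne']
    exact h_gapE N
  have h_lowlim : Tendsto (fun N : ℕ => eStar - C * (((N : ℝ) ^ (2 / 3 : ℝ)) / (N : ℝ)))
      atTop (𝓝 eStar) := by
    have := (tendsto_rpow_two_thirds_div_self.const_mul C).const_sub eStar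
    simpa using this
  have h_ge : eStar ≤ e := le_of_tendsto_of_tendsto h_lowlim he_lim h_div
  have h_eq : e = eStar := le_antisymm h_le h_ge
  rw [h_eq] at he_lim
  refine ⟨?_, he_lim⟩
  -- ZeroChargeBulk by squeezing
  intro x hx
  have h_up : Tendsto
      (fun N : ℕ => ((E N / N - eStar) + C * (((N : ℝ) ^ (2 / 3 : ℝ)) / (N : ℝ))) / κ)
      atTop (𝓝 0) := by
    have h1 : Tendsto (fun N : ℕ => E N / N - eStar) atTop (𝓝 0) := by
      simpa using he_lim.sub_const eStar
    have h2 := (h1.add (tendsto_rpow_two_thirds_div_self.const_mul C)).div_const κ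
    simpa using h2
  refine tendsto_of_tendsto_of_tendsto_of_le_of_le' tendsto_const_nhds h_up ?_ ?_
  · filter_upwards with N
    exact div_nonneg (Nat.cast_nonneg _) (Nat.cast_nonneg _)
  · filter_upwards [eventually_gt_atTop 0] with N hN
    have hN' : (0 : ℝ) < N := by exact_mod_cast hN
    obtain ⟨hx_inj, hx_E⟩ := hx N
    have h1 := hgap N (x N) hx_inj
    have h3 : interactionEnergy lennardJones (x N) = E N := hx_E
    set a : ℝ := (Nat.card {i : Fin N //
        ¬ Literature.Geometry.DiscreteGeometry.IsChargeFree (1 / 100 : ℝ) (x N) i} : ℝ) with ha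
    set P : ℝ := (N : ℝ) ^ (2 / 3 : ℝ) with hP
    have key : κ * a ≤ E N - N * eStar + C * P := by linarith
    have key' : κ * a / N ≤ (E N - N * eStar + C * P) / N :=
      div_le_div_of_nonneg_right key hN'.le
    have hrhs : (E N - N * eStar + C * P) / N = (E N / N - eStar) + C * (P / N) := by
      field_simp
    rw [le_div_iff₀ hκ, div_mul_eq_mul_div, mul_comm a κ, ← hrhs]
    exact key'

end Summit.AtomisticToContinuum.Crystallization.Theorems
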